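import Mathlib
import Literature.NumberTheory.LFunctions.Zhang2022.Section11WindowMeanSquare
import HarnessLib

/-!
# Zhang (2022) §11 p. 64 "Similarly": the `J₂` window mean square `Step11u019J2` reduced to the
# arithmetic sums `S_j` of Proposition 7.1

Topic `Literature/NumberTheory/LFunctions/Zhang2022` (Landau–Siegel audit tree; verdict-neutral).
Y. Zhang, *Discrete mean estimates and the Landau–Siegel zero*, arXiv:2211.02515v1 (2022)
[Zhang2022LandauSiegel] — **an unrefereed manuscript under adjudication; nothing here asserts or
denies its Theorems 1–2.** Companion of `Section11WindowMeanSquare` for the UNPRINTED `J₂`-twin of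
`Z22:§11.u019` hidden in the word "Similarly" (p. 64, tex L3306; typed CLAIM
`Typed.TypedSection11B.Step11u019J2`, cell GAP row G-L3t10-1): the weighted discrete mean square
over the zeros of `Σ_{n∈𝔍₂} χψ(n)n^{−ρ}(f̃(log n/log P + 0.004 − α̃) − g̃₂(n))`, where
`𝔍₂ ∩ ℕ = {n : nP^{0.004}/(Dt₀) ∈ 𝔍₁}` (`Typed.TypedSection11B.frakI2Nat`).

* sizes: `|g̃₂| ≤ 2`; `Dt₀ ≤ e^{520𝓛}`; `P₁η₊Dt₀ < PT⁻²` for `𝓛 ≥ 3`; members of `𝔍₂ ∩ ℕ` are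
  positive and `< P₁η₊Dt₀`, hence inside the truncation `n < ⌈PT⁻²⌉` of `A(𝐚;s,ψ)`;
* the `𝔍₂`-window sequence `𝐚 = χ(n)1_{𝔍₂}(n)(f̃(log n/log P + 0.004 − α̃) − g̃₂(n))` (inline)
  is admissible for (7.2) with `B = 3` (`adm72_window₂`) and `A(𝐚;s,ψ) = frakI2Sum`
  (`Apoly_window₂_eq_frakI2Sum`);
* `step11u019J2_of_sjWindow` — Lemma 2.3, Prop. 2.2 (i), Lemma 8.1, Prop. 7.1, `𝔞 ≫ 1` and
  "`𝓛⁹·S_j(𝐚,𝐚̄) → 0` (`j = 1,2,3`)" for this sequence imply `Step11u019J2 c′` (via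
  `Section11WindowMeanSquare.meanSquare_small_of_sj`); `step11u019J2_of_sjWindow_eventually` is
  the closed form over the tree theorems for Lemma 2.3 / Prop 2.2 (i) / Lemma 8.1 / Prop 7.1 /
  `𝔞 ≫ 1` — the leaf REDUCED to a statement about finite arithmetic sums.

Not here: the estimate of `S_j` at the `𝔍₂`-window sequence (the arithmetic half, a manuscript step;
`g̃₂(y) = g̃₁(yP^{0.004}/(Dt₀))` and `f̃(log n/log P + 0.004 − α̃) = f̃(log(nP^{0.004}/(Dt₀))/log P)`,
tree `Typed.TypedSection11B.gtilde2_eq_gtilde1_scaleJ2` / `tentArg_J2_eq`, carry (11.3) over).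
0 new definitions, 0 facts; standard axioms.

## References

* Y. Zhang, arXiv:2211.02515v1 (2022), §11 p. 64 (tex L3306 "Similarly"); §7 Prop. 7.1, (7.2);
  §8 Lemma 8.1; §2 (2.30). [cite: Zhang2022LandauSiegel, §11 p. 64]
-/

noncomputable section

open Complex Real ComplexConjugate

namespace Literature.NumberTheory.LFunctions.Zhang2022.Section11WindowMeanSquare

open Literature.NumberTheory.LFunctions.Zhang2022.Skeleton
open Literature.NumberTheory.LFunctions.Zhang2022.Typed.TypedSection11B
open Literature.NumberTheory.LFunctions.Zhang2022.Section11E2MeanSquare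

/-! ### Sizes: `𝔍₂ ∩ ℕ` lies below `PT⁻²` -/

section SizesJ2

variable (D : ℕ)

/-- **`|g̃₂(y)| ≤ 2`**, likewise. [cite: Zhang2022LandauSiegel, §11 p. 62; §4 (4.1)] -/
theorem abs_gtilde2_le_two (hL : 0 < ell D) (y : ℝ) : |gtilde2 D y| ≤ 2 := by
  have hΛ : 0 < ell D ^ 30 := pow_pos hL 30
  have hg : ∀ u : ℝ, ‖gW D u‖ ≤ 1 := fun u => by
    rw [gW, Real.norm_of_nonneg (GaussWeight.gWeight_pos hΛ u).le]
    exact (GaussWeight.gWeight_lt_one hΛ u).le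
  have h1 : ‖∫ z in (0.496 : ℝ)..0.498, gW D (bigP D ^ z * D * t0 D / y)‖ ≤
      1 * |(0.498 : ℝ) - 0.496| :=
    intervalIntegral.norm_integral_le_of_norm_le_const fun z _ => hg _
  have h2 : ‖∫ z in (0.498 : ℝ)..0.5, gW D (bigP D ^ z * D * t0 D / y)‖ ≤ 1 * |(0.5 : ℝ) - 0.498| :=
    intervalIntegral.norm_integral_le_of_norm_le_const fun z _ => hg _
  have e1 : (1 : ℝ) * |(0.498 : ℝ) - 0.496| = 2 / 1000 := by norm_num
  have e2 : (1 : ℝ) * |(0.5 : ℝ) - 0.498| = 2 / 1000 := by norm_num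
  rw [Real.norm_eq_abs, e1] at h1
  rw [Real.norm_eq_abs, e2] at h2
  rw [gtilde2]
  calc |-500 * (∫ z in (0.496 : ℝ)..0.498, gW D (bigP D ^ z * D * t0 D / y)) +
        500 * (∫ z in (0.498 : ℝ)..0.5, gW D (bigP D ^ z * D * t0 D / y))|
      ≤ |-500 * (∫ z in (0.496 : ℝ)..0.498, gW D (bigP D ^ z * D * t0 D / y))| +
        |500 * (∫ z in (0.498 : ℝ)..0.5, gW D (bigP D ^ z * D * t0 D / y))| := abs_add_le _ _
    _ = 500 * |∫ z in (0.496 : ℝ)..0.498, gW D (bigP D ^ z * D * t0 D / y)| +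
        500 * |∫ z in (0.498 : ℝ)..0.5, gW D (bigP D ^ z * D * t0 D / y)| := by
        rw [abs_mul, abs_mul]; norm_num
    _ ≤ 500 * (2 / 1000) + 500 * (2 / 1000) := by gcongr
    _ = 2 := by norm_num


/-- `L₀ ≤ log D` once `D ≥ ⌈e^{L₀}⌉`. [folklore] -/
private theorem le_log_of_ceil_exp_le {L₀ : ℝ} {D : ℕ} (hD : ⌈Real.exp L₀⌉₊ ≤ D) :
    L₀ ≤ Real.log D := by
  have h : Real.exp L₀ ≤ D := le_trans (Nat.le_ceil _) (by exact_mod_cast hD)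
  exact (Real.le_log_iff_exp_le (lt_of_lt_of_le (Real.exp_pos _) h)).mpr h

/-- `log D ≥ 3` forces `D ≥ 2`. [folklore] -/
private theorem two_le_of_three_le_log (hD : 3 ≤ Real.log D) : 2 ≤ D := by
  by_contra h
  push Not at h
  interval_cases D
  · norm_num at hD
  · norm_num at hD

/-- `Dt₀ ≤ e^{520𝓛}` (`D = e^𝓛`, `t₀ = 𝓛⁵¹⁹ ≤ e^{519𝓛}`), for `D ≥ 2`.
[cite: Zhang2022LandauSiegel, §2 (2.6)] -/
theorem D_mul_t0_le_exp (hD : 2 ≤ D) : (D : ℝ) * t0 D ≤ Real.exp (520 * ell D) := by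
  have hD0 : (0 : ℝ) < D := by exact_mod_cast (by omega : 0 < D)
  have hℓ0 : 0 ≤ ell D := Real.log_natCast_nonneg D
  have hDe : (D : ℝ) = Real.exp (ell D) := by rw [ell, Real.exp_log hD0]
  have h1 : ell D ≤ Real.exp (ell D) := by linarith [Real.add_one_le_exp (ell D)]
  have ht : t0 D ≤ Real.exp (519 * ell D) := by
    rw [t0]
    calc ell D ^ 519 ≤ Real.exp (ell D) ^ 519 := pow_le_pow_left₀ hℓ0 h1 519
      _ = Real.exp (519 * ell D) := by rw [← Real.exp_nat_mul]; norm_num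
  calc (D : ℝ) * t0 D ≤ (D : ℝ) * Real.exp (519 * ell D) := mul_le_mul_of_nonneg_left ht hD0.le
    _ = Real.exp (ell D) * Real.exp (519 * ell D) := by rw [← hDe]
    _ = Real.exp (ell D + 519 * ell D) := (Real.exp_add _ _).symm
    _ = Real.exp (520 * ell D) := by ring_nf

/-- For `𝓛 ≥ 3`: `P₁η₊Dt₀ < PT⁻²` (`0.504𝓛⁹ + 𝓛⁻¹⁰ + 520𝓛 < 𝓛⁹ − 2𝓛^{1.1}`).
[cite: Zhang2022LandauSiegel, §7 (7.2); §11 p. 64] -/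
theorem P1_mul_etaPM_mul_Dt0_lt_P_div_T_sq (hD : 3 ≤ Real.log D) :
    Skeleton.P1 D * etaPM D 1 * ((D : ℝ) * t0 D) < bigP D / bigT D ^ 2 := by
  have hℓ : 3 ≤ ell D := by rw [ell]; exact hD
  have h1 : (1 : ℝ) ≤ ell D := by linarith
  have h0 : (0 : ℝ) < ell D := by linarith
  have hD2 : 2 ≤ D := two_le_of_three_le_log D hD
  have hDt : (D : ℝ) * t0 D ≤ Real.exp (520 * ell D) := D_mul_t0_le_exp D hD2
  have hDt0 : 0 < (D : ℝ) * t0 D := by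
    have : (0 : ℝ) < D := by exact_mod_cast (by omega : 0 < D)
    exact mul_pos this (pow_pos h0 _)
  have hlhs : Skeleton.P1 D * etaPM D 1 * ((D : ℝ) * t0 D) ≤
      Real.exp (0.504 * ell D ^ 9 + (ell D ^ 10)⁻¹ + 520 * ell D) := by
    have e1 : Skeleton.P1 D * etaPM D 1 = Real.exp (0.504 * ell D ^ 9 + (ell D ^ 10)⁻¹) := by
      rw [Skeleton.P1, etaPM, bigP, ← Real.exp_mul, ← Real.exp_add]; ring_nf
    rw [e1]
    calc Real.exp (0.504 * ell D ^ 9 + (ell D ^ 10)⁻¹) * ((D : ℝ) * t0 D)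
        ≤ Real.exp (0.504 * ell D ^ 9 + (ell D ^ 10)⁻¹) * Real.exp (520 * ell D) :=
          mul_le_mul_of_nonneg_left hDt (Real.exp_pos _).le
      _ = Real.exp (0.504 * ell D ^ 9 + (ell D ^ 10)⁻¹ + 520 * ell D) := (Real.exp_add _ _).symm
  have hrhs : bigP D / bigT D ^ 2 = Real.exp (ell D ^ 9 - 2 * ell D ^ (1.1 : ℝ)) := by
    rw [bigP, bigT, ← Real.exp_nat_mul, ← Real.exp_sub]; push_cast; ring_nf
  rw [hrhs]
  refine lt_of_le_of_lt hlhs (Real.exp_lt_exp.mpr ?_)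
  have h11 : ell D ^ (1.1 : ℝ) ≤ ell D ^ (2 : ℝ) :=
    Real.rpow_le_rpow_of_exponent_le h1 (by norm_num)
  rw [Real.rpow_two] at h11
  have hinv : (ell D ^ 10)⁻¹ ≤ 1 := inv_le_one_of_one_le₀ (one_le_pow₀ h1)
  have h7 : (2187 : ℝ) ≤ ell D ^ 7 := by
    calc (2187 : ℝ) = 3 ^ 7 := by norm_num
      _ ≤ ell D ^ 7 := pow_le_pow_left₀ (by norm_num) hℓ 7
  have h9 : 2187 * ell D ^ 2 ≤ ell D ^ 9 := by
    have := mul_le_mul_of_nonneg_left h7 (pow_nonneg h0.le 2)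
    calc 2187 * ell D ^ 2 = ell D ^ 2 * 2187 := by ring
      _ ≤ ell D ^ 2 * ell D ^ 7 := this
      _ = ell D ^ 9 := by ring
  have h4 : 3 * ell D ≤ ell D ^ 2 := by nlinarith
  nlinarith

/-- Members of `𝔍₂ ∩ ℕ` are positive and `< P₁η₊Dt₀` (their scaled points `nP^{0.004}/(Dt₀)` lie
in `𝔍₁ ⊂ (0, P₁η₊)`, and `P^{0.004} ≥ 1`), for `D ≥ 2`. [cite: Zhang2022LandauSiegel, §11 p. 64] -/
theorem pos_and_lt_of_mem_frakI2Nat (hD : 2 ≤ D) {n : ℕ} (hn : n ∈ frakI2Nat D) :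
    0 < n ∧ (n : ℝ) < Skeleton.P1 D * etaPM D 1 * ((D : ℝ) * t0 D) := by
  rw [mem_frakI2Nat_iff hD, mem_frakI1_iff] at hn
  obtain ⟨a, ha, h1, h2⟩ := hn
  have hP1 : 1 ≤ bigP D := Real.one_le_exp (pow_nonneg (Real.log_natCast_nonneg D) 9)
  have hP0 : 0 < bigP D := Real.exp_pos _
  have hD0 : (0 : ℝ) < D := by exact_mod_cast (by omega : 0 < D)
  have hℓ0 : 0 < ell D := by
    rw [ell]; exact Real.log_pos (by exact_mod_cast (by omega : 1 < D))
  have hDt : 0 < (D : ℝ) * t0 D := mul_pos hD0 (pow_pos hℓ0 _)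
  have ha' : a ≤ 0.504 := by
    simp only [Finset.mem_insert, Finset.mem_singleton] at ha
    rcases ha with rfl | rfl | rfl <;> norm_num
  have hlow : 0 < scaleJ2 D n :=
    lt_trans (mul_pos (Real.rpow_pos_of_pos hP0 a) (Real.exp_pos _)) h1
  have hn0 : (0 : ℝ) < n := by
    by_contra hc
    push Not at hc
    have : scaleJ2 D n ≤ 0 := by
      rw [scaleJ2]
      exact div_nonpos_of_nonpos_of_nonneg
        (mul_nonpos_of_nonpos_of_nonneg hc (Real.rpow_pos_of_pos hP0 _).le) hDt.le
    linarith
  refine ⟨by exact_mod_cast hn0, ?_⟩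
  have hup : scaleJ2 D n < Skeleton.P1 D * etaPM D 1 :=
    lt_of_lt_of_le h2 (mul_le_mul_of_nonneg_right
      (Real.rpow_le_rpow_of_exponent_le hP1 ha') (Real.exp_pos _).le)
  rw [scaleJ2, div_lt_iff₀ hDt] at hup
  have hP4 : 1 ≤ bigP D ^ (0.004 : ℝ) := Real.one_le_rpow hP1 (by norm_num)
  calc (n : ℝ) ≤ n * bigP D ^ (0.004 : ℝ) := le_mul_of_one_le_right hn0.le hP4
    _ < Skeleton.P1 D * etaPM D 1 * ((D : ℝ) * t0 D) := hup

/-- For `𝓛 ≥ 3`: members of `𝔍₂ ∩ ℕ` are `< PT⁻²`. [cite: Zhang2022LandauSiegel, §7 (7.2); §11 p. 64] -/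
theorem lt_P_div_T_sq_of_mem_frakI2Nat (hD : 3 ≤ Real.log D) {n : ℕ} (hn : n ∈ frakI2Nat D) :
    (n : ℝ) < bigP D / bigT D ^ 2 :=
  (pos_and_lt_of_mem_frakI2Nat D (two_le_of_three_le_log D hD) hn).2.trans
    (P1_mul_etaPM_mul_Dt0_lt_P_div_T_sq D hD)

/-- For `𝓛 ≥ 3`: `𝔍₂ ∩ ℕ ⊆ [0, ⌈PT⁻²⌉)`. [cite: Zhang2022LandauSiegel, §7 (7.2); §11 p. 64] -/
theorem frakI2Nat_subset_range (hD : 3 ≤ Real.log D) : frakI2Nat D ⊆ Finset.range (Nsupp D) := by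
  intro n hn
  rw [Finset.mem_range, Nsupp]
  exact Nat.lt_ceil.mpr (lt_P_div_T_sq_of_mem_frakI2Nat D hD hn)

end SizesJ2

section WindowJ2

variable {D : ℕ} [NeZero D] (χ : DirichletCharacter ℂ D) (x : Chr D)

omit [NeZero D] in
/-- **The `𝔍₂`-window sequence `𝐚(n) = χ(n)1_{𝔍₂}(n)(f̃(log n/log P + 0.004 − α̃) − g̃₂(n))` is
admissible for (7.2) with `B = 3`** (`𝓛 ≥ 3`, so that `𝔍₂ ∩ ℕ ⊂ (0, PT⁻²)`).
[cite: Zhang2022LandauSiegel, §7 (7.2); §11 p. 64, tex L3306] -/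
theorem adm72_window₂ (hD : 3 ≤ Real.log D) :
    Adm72 D 3 (fun n : ℕ => if n ∈ frakI2Nat D then χ (n : ZMod D) *
      (((ftilde (Real.log n / Real.log (bigP D) + 0.004 - alphaTilde D) : ℝ) : ℂ) -
        ((gtilde2 D n : ℝ) : ℂ)) else 0) := by
  have hL : 0 < ell D := by rw [ell]; linarith
  refine ⟨fun n => ?_, fun n hn => ?_⟩ <;> dsimp only
  · by_cases h : n ∈ frakI2Nat D
    · rw [if_pos h, norm_mul]
      have hχ : ‖χ (n : ZMod D)‖ ≤ 1 := DirichletCharacter.norm_le_one _ _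
      have hw : ‖(((ftilde (Real.log n / Real.log (bigP D) + 0.004 - alphaTilde D) : ℝ) : ℂ) -
          ((gtilde2 D n : ℝ) : ℂ))‖ ≤ 3 := by
        calc _ ≤ ‖((ftilde (Real.log n / Real.log (bigP D) + 0.004 - alphaTilde D) : ℝ) : ℂ)‖ +
              ‖((gtilde2 D n : ℝ) : ℂ)‖ := norm_sub_le _ _
          _ = |ftilde (Real.log n / Real.log (bigP D) + 0.004 - alphaTilde D)| + |gtilde2 D n| := by
              rw [Complex.norm_real, Complex.norm_real, Real.norm_eq_abs, Real.norm_eq_abs]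
          _ ≤ 1 + 2 := add_le_add (abs_ftilde_le_one _) (abs_gtilde2_le_two D hL _)
          _ = 3 := by norm_num
      calc ‖χ (n : ZMod D)‖ * ‖(((ftilde (Real.log n / Real.log (bigP D) + 0.004 - alphaTilde D)
              : ℝ) : ℂ) - ((gtilde2 D n : ℝ) : ℂ))‖
          ≤ 1 * 3 := mul_le_mul hχ hw (norm_nonneg _) zero_le_one
        _ = 3 := by norm_num
    · rw [if_neg h, norm_zero]; norm_num
  · rw [if_neg]
    intro h
    have := lt_P_div_T_sq_of_mem_frakI2Nat D hD h
    linarith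

omit [NeZero D] in
/-- **`A(𝐚;s,ψ) = Σ_{n∈𝔍₂} χψ(n)n^{−s}(f̃(log n/log P + 0.004 − α̃) − g̃₂(n))`** for the
`𝔍₂`-window sequence (`𝓛 ≥ 3`): the Dirichlet polynomial of `Z22:§11.u021`'s window mean square IS
`Typed.TypedSection11B.frakI2Sum`. [cite: Zhang2022LandauSiegel, §11 p. 64, tex L3306] -/
theorem Apoly_window₂_eq_frakI2Sum (hD : 3 ≤ Real.log D) (s : ℂ) :
    Apoly x (fun n : ℕ => if n ∈ frakI2Nat D then χ (n : ZMod D) *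
      (((ftilde (Real.log n / Real.log (bigP D) + 0.004 - alphaTilde D) : ℝ) : ℂ) -
        ((gtilde2 D n : ℝ) : ℂ)) else 0) s = frakI2Sum χ x s := by
  rw [Apoly, Lemma81.dirPoly_def, frakI2Sum, ← Finset.sum_subset (frakI2Nat_subset_range D hD)]
  · refine Finset.sum_congr rfl fun n hn => ?_
    rw [if_pos hn, pc]
    ring
  · intro n _ hn
    rw [if_neg hn]; ring

end WindowJ2

/-! ### `Z22:§11.u021`'s window mean square `Step11u019J2` reduced to `S_j` -/

section ReductionJ2

variable (c' : ℝ)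

/-- **`Step11u019J2` from an `S_j`-estimate** (the unprinted `J₂`-twin behind "Similarly", p. 64):
Lemma 2.3, Prop. 2.2 (i), Lemma 8.1, Prop. 7.1, `𝔞 ≫ 1` and "`𝓛⁹·S_j(𝐚,𝐚̄) → 0` (`j = 1,2,3`)" for
the `𝔍₂`-window sequence imply `ΣΣ𝔠*|Σ_{n∈𝔍₂}χψ(n)n^{−ρ}(f̃(… + 0.004 − α̃) − g̃₂)(n)|²ω = o(𝔞𝔓)`.
[cite: Zhang2022LandauSiegel, §11 p. 64, tex L3306] -/
theorem step11u019J2_of_sjWindow (h23 : Lemma23 c') (h22 : Prop22i) (h81 : Lemma81 c')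
    (h71 : Prop71 c') (ha : FrakALowerBound)
    (hS : ∀ ε : ℝ, 0 < ε → ForAllLarge fun D _ χ => AssumptionA D χ →
      ∀ j ∈ ({1, 2, 3} : Finset ℕ), ell D ^ 9 * ‖Sj c' D j
        (fun n : ℕ => if n ∈ frakI2Nat D then χ (n : ZMod D) *
          (((ftilde (Real.log n / Real.log (bigP D) + 0.004 - alphaTilde D) : ℝ) : ℂ) -
            ((gtilde2 D n : ℝ) : ℂ)) else 0)
        (fun n : ℕ => conj (if n ∈ frakI2Nat D then χ (n : ZMod D) *
          (((ftilde (Real.log n / Real.log (bigP D) + 0.004 - alphaTilde D) : ℝ) : ℂ) -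
            ((gtilde2 D n : ℝ) : ℂ)) else 0))‖ ≤ ε) :
    Step11u019J2 c' := by
  have hadm : ForAllLarge fun D _ χ => Adm72 D 3 (fun n : ℕ => if n ∈ frakI2Nat D then
      χ (n : ZMod D) * (((ftilde (Real.log n / Real.log (bigP D) + 0.004 - alphaTilde D) : ℝ) : ℂ) -
        ((gtilde2 D n : ℝ) : ℂ)) else 0) :=
    ⟨⌈Real.exp 3⌉₊, fun D _ χ hD _ _ => adm72_window₂ χ (le_log_of_ceil_exp_le hD)⟩
  have hcore := meanSquare_small_of_sj c' h23 h22 h81 h71 ha 3 (fun D χ n =>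
    if n ∈ frakI2Nat D then χ (n : ZMod D) *
      (((ftilde (Real.log n / Real.log (bigP D) + 0.004 - alphaTilde D) : ℝ) : ℂ) -
        ((gtilde2 D n : ℝ) : ℂ)) else 0) hadm hS
  intro ε hε
  obtain ⟨D₀, h⟩ := hcore ε hε
  refine ⟨max D₀ ⌈Real.exp 3⌉₊, fun D _ χ hD hq hp hA => ?_⟩
  have hlog : 3 ≤ Real.log D := le_log_of_ceil_exp_le (le_trans (le_max_right _ _) hD)
  have h' := h D χ (le_trans (le_max_left _ _) hD) hq hp hA
  calc ∑ i ∈ idx χ, (cstar c' D i.1 i.2).re * ‖frakI2Sum χ i.1 i.2‖ ^ 2 * (omegaW D i.2).re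
      = ∑ i ∈ idx χ, (cstar c' D i.1 i.2).re * ‖Apoly i.1 (fun n : ℕ => if n ∈ frakI2Nat D then
          χ (n : ZMod D) * (((ftilde (Real.log n / Real.log (bigP D) + 0.004 - alphaTilde D) : ℝ)
            : ℂ) - ((gtilde2 D n : ℝ) : ℂ)) else 0) i.2‖ ^ 2 * (omegaW D i.2).re := by
        refine Finset.sum_congr rfl fun i _ => ?_
        rw [Apoly_window₂_eq_frakI2Sum χ i.1 hlog]
    _ ≤ ε * frakA χ * frakP D := h'

/-- **`Step11u019J2` from the `S_j`-estimate alone, for every sufficiently large `c′`** (inputs: the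
tree theorems `Skeleton.lemma23_eventually`, `prop22i_holds`, `lemma81_eventually`,
`Section7cStatements.prop71X_holds`, `frakALowerBound_holds`).
[cite: Zhang2022LandauSiegel, §11 p. 64, tex L3306] -/
theorem step11u019J2_of_sjWindow_eventually :
    ∃ c₀ : ℝ, 0 ≤ c₀ ∧ ∀ c' : ℝ, c₀ ≤ c' →
      (∀ ε : ℝ, 0 < ε → ForAllLarge fun D _ χ => AssumptionA D χ →
        ∀ j ∈ ({1, 2, 3} : Finset ℕ), ell D ^ 9 * ‖Sj c' D j
          (fun n : ℕ => if n ∈ frakI2Nat D then χ (n : ZMod D) *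
            (((ftilde (Real.log n / Real.log (bigP D) + 0.004 - alphaTilde D) : ℝ) : ℂ) -
              ((gtilde2 D n : ℝ) : ℂ)) else 0)
          (fun n : ℕ => conj (if n ∈ frakI2Nat D then χ (n : ZMod D) *
            (((ftilde (Real.log n / Real.log (bigP D) + 0.004 - alphaTilde D) : ℝ) : ℂ) -
              ((gtilde2 D n : ℝ) : ℂ)) else 0))‖ ≤ ε) →
      Step11u019J2 c' := by
  obtain ⟨c₁, h1, h23⟩ := lemma23_eventually
  obtain ⟨c₂, -, h81⟩ := lemma81_eventually
  exact ⟨max c₁ c₂, le_trans h1 (le_max_left _ _), fun c' hc' hS =>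
    step11u019J2_of_sjWindow c' (h23 c' ((le_max_left _ _).trans hc')) prop22i_holds
      (h81 c' ((le_max_right _ _).trans hc')) (Section7cStatements.prop71X_holds c')
      frakALowerBound_holds hS⟩

end ReductionJ2

end Literature.NumberTheory.LFunctions.Zhang2022.Section11WindowMeanSquare
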